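import Summits.KontsevichZagierPeriods.KontsevichZagierPeriods.Theorems.SymplecticScissorsRealOnePeriodRelationsStubPuiseuxGermAux
import Summits.KontsevichZagierPeriods.KontsevichZagierPeriods.Theorems.SymplecticScissorsCurvePeriodsTransferStubSaPieceFacts
import Literature.FieldTheory.AlgClosed.PuiseuxAnalyticBranches
import Literature.FieldTheory.AlgClosed.PuiseuxRealBranchAux
import Literature.FieldTheory.AlgClosed.PuiseuxFormalBranches
import Literature.NumberTheory.Transcendental.SemialgebraicMaps
import Mathlib.Analysis.Complex.Polynomial.Basic
import HarnessLib

/-!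
# The real Puiseux germ of a one-variable `ℚ`-semialgebraic function

For `f : ℝ → ℝ` which is `ℚ`-semialgebraic on `(a, a + δ)` (`a` algebraic, `δ > 0`) there are `q ≥ 1`, `m ∈ ℤ`
and `h` real-analytic at `0` with algebraic Taylor coefficients, `h(0) ≠ 0` or `h ≡ 0`, such that
`f(a + s^q) = s^m · h(s)` for all small `s > 0` (`puiseuxGerm`; registered anchor `helper_puiseuxGerm_2`; the
statement is VERBATIM the registered stub `stub_puiseuxGerm` of the sibling crux `CurvePeriodsTransfer`, line
`standard-etale-models`, and the last missing input of `stub_arcSymbols` of line `nash-retraction-thin-strip`).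

Proof.  On the first analytic cell `(a, b)` of `f` (`CurvePeriodsTransfer.stub_saPieceFacts`) the graph of `f`
lies on a real plane curve `P = 0` with algebraic coefficients; recentre at `a` over `k = algebraicClosure ℚ ℂ`,
pass to an irreducible factor `Q` vanishing along the arc, separable over `k⸨s⸩`; Newton–Puiseux
(`Literature.FieldTheory.AlgClosed.exists_formalBranches`) and the analytic realisation of the formal branches
(`exists_analyticBranches`) with branch selection by connectedness (`exists_branch_eqOn`) give a holomorphic `Y`
with `sᴺ f(a + sⁿ) = Y(s)` on `(0, ε)`; re-running the realisation with larger truncation orders shows that ALL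
Taylor coefficients of `Y` are algebraic (`exists_realBranch`); finally `Y = s^M · H`, `H(0) ≠ 0` (isolated
zeros) and `h = Re H` on the real axis.
[cite: BochnakCosteRoy1998, §8.1] [cite: Kollar2007, 1.94–1.95]
-/

noncomputable section

open Polynomial Filter Topology Set
open scoped PowerSeries
open Literature.FieldTheory.AlgClosed
open Literature.NumberTheory.Transcendental

namespace Summit.KontsevichZagierPeriods.SymplecticScissors.RealOnePeriodRelations

namespace PuiseuxGerm

/-! ### The analytic branch through the real arc, with algebraic Taylor coefficients -/

/-- Elements of `algebraicClosure ℚ ℂ`, mapped to `ℂ`, are algebraic. [folklore] -/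
theorem isAlgebraic_algebraMap_algebraicClosure (x : algebraicClosure ℚ ℂ) :
    IsAlgebraic ℚ (algebraMap (algebraicClosure ℚ ℂ) ℂ x) :=
  mem_algebraicClosure_iff.1 x.2

section Branch

variable (Q : (algebraicClosure ℚ ℂ)[X][X]) {n N : ℕ} (S : Finset (algebraicClosure ℚ ℂ)⟦X⟧)

/-- **One analytic branch carries the real arc (for a prescribed truncation order).** With the formal Puiseux
data `(n, N, S)` of `Q` and a continuous `f` on `(a, b)` with `Q(x − a, f x) = 0`, for every `N₀` there are a
function `Y`, holomorphic at `0`, whose Taylor coefficients of order `< N₀` are algebraic, and `ε > 0` with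
`sᴺ · f(a + sⁿ) = Y(s)` for `s ∈ (0, ε)`. [cite: Kollar2007, 1.94–1.95] -/
theorem exists_branch_of_order (hn : 0 < n)
    (hF : (Polynomial.scaleRoots (Q.map (Polynomial.expand (algebraicClosure ℚ ℂ) n :
        (algebraicClosure ℚ ℂ)[X] →ₐ[algebraicClosure ℚ ℂ] (algebraicClosure ℚ ℂ)[X]).toRingHom)
        ((X : (algebraicClosure ℚ ℂ)[X]) ^ N)).map
          (Polynomial.coeToPowerSeries.ringHom :
            (algebraicClosure ℚ ℂ)[X] →+* (algebraicClosure ℚ ℂ)⟦X⟧) =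
      Polynomial.C (((Polynomial.expand (algebraicClosure ℚ ℂ) n Q.leadingCoeff :
          (algebraicClosure ℚ ℂ)[X]) : (algebraicClosure ℚ ℂ)⟦X⟧)) *
        ∏ v ∈ S, (Polynomial.X - Polynomial.C v))
    (hlc : Polynomial.expand (algebraicClosure ℚ ℂ) n Q.leadingCoeff ≠ 0)
    {f : ℝ → ℝ} {a b : ℝ} (hab : a < b) (hfc : ContinuousOn f (Ioo a b))
    (hfQ : ∀ x ∈ Ioo a b,
      (Q.map (eval₂RingHom (algebraMap (algebraicClosure ℚ ℂ) ℂ) ((x : ℂ) - a))).eval ((f x : ℝ) : ℂ) = 0)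
    (N₀ : ℕ) :
    ∃ (Y : ℂ → ℂ) (ε : ℝ), 0 < ε ∧ AnalyticAt ℂ Y 0 ∧ (∀ j, j < N₀ → IsAlgebraic ℚ (iteratedDeriv j Y 0)) ∧
      ∀ s ∈ Ioo (0 : ℝ) ε, ((s : ℝ) : ℂ) ^ N * ((f (a + s ^ n) : ℝ) : ℂ) = Y s := by
  classical
  obtain ⟨Nv, ρ, r, hr, hNv, hρan, -, hexh, hdist⟩ := exists_analyticBranches _ _ S hlc hF N₀
  -- the branches
  obtain ⟨Y, hY⟩ : ∃ Y : (algebraicClosure ℚ ℂ)⟦X⟧ → ℂ → ℂ, ∀ v, Y v = fun s =>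
      ((PowerSeries.trunc (Nv v) v).map (algebraMap (algebraicClosure ℚ ℂ) ℂ)).eval s + s ^ Nv v * ρ v s :=
    ⟨_, fun _ => rfl⟩
  have hYapp : ∀ v s, Y v s = Polynomial.eval₂ (algebraMap (algebraicClosure ℚ ℂ) ℂ) s
      (PowerSeries.trunc (Nv v) v) + s ^ Nv v * ρ v s := by
    intro v s; simp only [hY, Polynomial.eval_map]
  have hYan : ∀ v ∈ S, ∀ s ∈ Metric.ball (0 : ℂ) r, AnalyticAt ℂ (Y v) s := by
    intro v hv s hs
    rw [hY]
    exact ((AnalyticOnNhd.eval_polynomial (𝕜 := ℂ)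
      ((PowerSeries.trunc (Nv v) v).map (algebraMap (algebraicClosure ℚ ℂ) ℂ))) s (Set.mem_univ _)).add
      (((analyticAt_id (𝕜 := ℂ)).pow _).mul (hρan v hv s hs))
  -- the interval `(0, ε)`, `ε = min r (min 1 (b - a))`
  have hεpos : 0 < min r (min 1 (b - a)) := lt_min hr (lt_min one_pos (sub_pos.2 hab))
  have hεr : min r (min 1 (b - a)) ≤ r := min_le_left _ _
  have hmemI : ∀ s ∈ Ioo (0 : ℝ) (min r (min 1 (b - a))), a + s ^ n ∈ Ioo a b := by
    intro s hs
    have hs1 : s < 1 := lt_of_lt_of_le hs.2 ((min_le_right _ _).trans (min_le_left _ _))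
    have hsba : s < b - a := lt_of_lt_of_le hs.2 ((min_le_right _ _).trans (min_le_right _ _))
    have hpow_pos : 0 < s ^ n := pow_pos hs.1 n
    have hpow_le : s ^ n ≤ s := by
      calc s ^ n ≤ s ^ 1 := pow_le_pow_of_le_one hs.1.le hs1.le hn
        _ = s := pow_one s
    exact ⟨by linarith, by linarith⟩
  have hball : ∀ s ∈ Ioo (0 : ℝ) (min r (min 1 (b - a))),
      ((s : ℝ) : ℂ) ∈ Metric.ball (0 : ℂ) r ∧ ((s : ℝ) : ℂ) ≠ 0 := by
    intro s hs
    refine ⟨?_, by exact_mod_cast hs.1.ne'⟩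
    rw [Metric.mem_ball, dist_zero_right, Complex.norm_real, Real.norm_eq_abs, abs_of_pos hs.1]
    exact lt_of_lt_of_le hs.2 hεr
  -- `F̂(s, sᴺ·W) = (sᴺ)^deg · Q(sⁿ, W)`
  have hFhQ : ∀ (s W : ℂ),
      ((Polynomial.scaleRoots (Q.map (Polynomial.expand (algebraicClosure ℚ ℂ) n :
        (algebraicClosure ℚ ℂ)[X] →ₐ[algebraicClosure ℚ ℂ] (algebraicClosure ℚ ℂ)[X]).toRingHom)
        ((X : (algebraicClosure ℚ ℂ)[X]) ^ N)).map
          (eval₂RingHom (algebraMap (algebraicClosure ℚ ℂ) ℂ) s)).eval (s ^ N * W) =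
      (s ^ N) ^ (Q.map (Polynomial.expand (algebraicClosure ℚ ℂ) n :
        (algebraicClosure ℚ ℂ)[X] →ₐ[algebraicClosure ℚ ℂ] (algebraicClosure ℚ ℂ)[X]).toRingHom).natDegree *
        (Q.map (eval₂RingHom (algebraMap (algebraicClosure ℚ ℂ) ℂ) (s ^ n))).eval W := by
    intro s W
    have hφ : (eval₂RingHom (algebraMap (algebraicClosure ℚ ℂ) ℂ) s :
        (algebraicClosure ℚ ℂ)[X] →+* ℂ) ((X : (algebraicClosure ℚ ℂ)[X]) ^ N) = s ^ N := by
      simp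
    have key := Polynomial.scaleRoots_eval₂_mul
      (p := Q.map (Polynomial.expand (algebraicClosure ℚ ℂ) n :
        (algebraicClosure ℚ ℂ)[X] →ₐ[algebraicClosure ℚ ℂ] (algebraicClosure ℚ ℂ)[X]).toRingHom)
      (eval₂RingHom (algebraMap (algebraicClosure ℚ ℂ) ℂ) s : (algebraicClosure ℚ ℂ)[X] →+* ℂ) W
      ((X : (algebraicClosure ℚ ℂ)[X]) ^ N)
    rw [hφ] at key
    rw [eval_map, key, eval_map, Polynomial.eval₂_map]
    congr 1
    have hcomp : (eval₂RingHom (algebraMap (algebraicClosure ℚ ℂ) ℂ) s :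
        (algebraicClosure ℚ ℂ)[X] →+* ℂ).comp
        (Polynomial.expand (algebraicClosure ℚ ℂ) n :
          (algebraicClosure ℚ ℂ)[X] →ₐ[algebraicClosure ℚ ℂ] (algebraicClosure ℚ ℂ)[X]).toRingHom =
        eval₂RingHom (algebraMap (algebraicClosure ℚ ℂ) ℂ) (s ^ n) := by
      refine Polynomial.ringHom_ext (fun c => ?_) ?_
      · simp
      · simp
    rw [hcomp]
  -- on `(0, ε)` the arc lies on some branch
  have hex : ∀ s ∈ Ioo (0 : ℝ) (min r (min 1 (b - a))), ∃ v ∈ S,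
      (((fun s : ℝ => s ^ N * f (a + s ^ n)) s : ℝ) : ℂ) = Y v ((s : ℝ) : ℂ) := by
    intro s hs
    have hroot : ((Polynomial.scaleRoots (Q.map (Polynomial.expand (algebraicClosure ℚ ℂ) n :
        (algebraicClosure ℚ ℂ)[X] →ₐ[algebraicClosure ℚ ℂ] (algebraicClosure ℚ ℂ)[X]).toRingHom)
        ((X : (algebraicClosure ℚ ℂ)[X]) ^ N)).map
          (eval₂RingHom (algebraMap (algebraicClosure ℚ ℂ) ℂ) ((s : ℝ) : ℂ))).eval
        (((s : ℝ) : ℂ) ^ N * ((f (a + s ^ n) : ℝ) : ℂ)) = 0 := by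
      rw [hFhQ]
      have h := hfQ (a + s ^ n) (hmemI s hs)
      have hcast : (((a + s ^ n : ℝ) : ℂ) - a) = ((s : ℝ) : ℂ) ^ n := by push_cast; ring
      rw [hcast] at h
      rw [h, mul_zero]
    obtain ⟨v, hv, hvW⟩ := hexh _ (hball s hs).1 (hball s hs).2 _ hroot
    refine ⟨v, hv, ?_⟩
    rw [hYapp]
    push_cast
    exact hvW
  -- continuity of `s ↦ sᴺ f(a + sⁿ)` on `(0, ε)`
  have hgc : ContinuousOn (fun s : ℝ => s ^ N * f (a + s ^ n)) (Ioo 0 (min r (min 1 (b - a)))) := by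
    refine (continuousOn_id.pow N).mul ?_
    exact hfc.comp (continuousOn_const.add (continuousOn_id.pow n)) fun s hs => hmemI s hs
  have hYc : ∀ v ∈ S, ∀ s ∈ Metric.ball (0 : ℂ) r, ContinuousAt (Y v) s := fun v hv s hs =>
    (hYan v hv s hs).continuousAt
  have hdist' : ∀ s ∈ Metric.ball (0 : ℂ) r, s ≠ 0 → ∀ v ∈ S, ∀ v' ∈ S, v ≠ v' → Y v s ≠ Y v' s := by
    intro s hs hs0 v hv v' hv' hne
    rw [hYapp, hYapp]
    exact hdist s hs hs0 v hv v' hv' hne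
  obtain ⟨v₀, hv₀, hsel⟩ := exists_branch_eqOn S Y hεpos hεr hYc hdist' _ hgc hex
  refine ⟨Y v₀, min r (min 1 (b - a)), hεpos, hYan v₀ hv₀ 0 (Metric.mem_ball_self hr), fun j hj => ?_,
    fun s hs => ?_⟩
  · -- Taylor coefficients below `N₀ ≤ Nv v₀`
    have hjN : j < Nv v₀ := lt_of_lt_of_le hj (hNv v₀ hv₀)
    rw [hY, iteratedDeriv_shiftedBranch_zero (hρan v₀ hv₀ 0 (Metric.mem_ball_self hr)) _ hjN,
      Polynomial.coeff_map, coeff_trunc_of_lt hjN]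
    refine IsAlgebraic.mul ?_ (isAlgebraic_algebraMap_algebraicClosure _)
    have hfac : ((j.factorial : ℕ) : ℂ) = algebraMap ℚ ℂ (j.factorial : ℚ) := by simp
    rw [hfac]
    exact isAlgebraic_algebraMap _
  · have h := hsel s hs
    push_cast at h
    exact h

/-- **The real arc's branch has algebraic Taylor coefficients of every order.** [cite: Kollar2007, 1.94–1.95] -/
theorem exists_realBranch (hn : 0 < n)
    (hF : (Polynomial.scaleRoots (Q.map (Polynomial.expand (algebraicClosure ℚ ℂ) n :
        (algebraicClosure ℚ ℂ)[X] →ₐ[algebraicClosure ℚ ℂ] (algebraicClosure ℚ ℂ)[X]).toRingHom)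
        ((X : (algebraicClosure ℚ ℂ)[X]) ^ N)).map
          (Polynomial.coeToPowerSeries.ringHom :
            (algebraicClosure ℚ ℂ)[X] →+* (algebraicClosure ℚ ℂ)⟦X⟧) =
      Polynomial.C (((Polynomial.expand (algebraicClosure ℚ ℂ) n Q.leadingCoeff :
          (algebraicClosure ℚ ℂ)[X]) : (algebraicClosure ℚ ℂ)⟦X⟧)) *
        ∏ v ∈ S, (Polynomial.X - Polynomial.C v))
    (hlc : Polynomial.expand (algebraicClosure ℚ ℂ) n Q.leadingCoeff ≠ 0)
    {f : ℝ → ℝ} {a b : ℝ} (hab : a < b) (hfc : ContinuousOn f (Ioo a b))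
    (hfQ : ∀ x ∈ Ioo a b,
      (Q.map (eval₂RingHom (algebraMap (algebraicClosure ℚ ℂ) ℂ) ((x : ℂ) - a))).eval ((f x : ℝ) : ℂ) = 0) :
    ∃ (Y : ℂ → ℂ) (ε : ℝ), 0 < ε ∧ AnalyticAt ℂ Y 0 ∧ (∀ j, IsAlgebraic ℚ (iteratedDeriv j Y 0)) ∧
      ∀ s ∈ Ioo (0 : ℝ) ε, ((s : ℝ) : ℂ) ^ N * ((f (a + s ^ n) : ℝ) : ℂ) = Y s := by
  obtain ⟨Y, ε, hε, hYan, -, hYeq⟩ := exists_branch_of_order Q S hn hF hlc hab hfc hfQ 0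
  refine ⟨Y, ε, hε, hYan, fun j => ?_, hYeq⟩
  obtain ⟨Y', ε', hε', hY'an, hY'alg, hY'eq⟩ := exists_branch_of_order Q S hn hF hlc hab hfc hfQ (j + 1)
  -- `Y = Y'` on `(0, min ε ε')`, hence near `0`
  have hD : AnalyticAt ℂ (fun z => Y z - Y' z) 0 := hYan.sub hY'an
  have hD0 : ∀ s ∈ Ioo (0 : ℝ) (min ε ε'), (fun z => Y z - Y' z) s = 0 := by
    intro s hs
    have h1 := hYeq s ⟨hs.1, lt_of_lt_of_le hs.2 (min_le_left _ _)⟩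
    have h2 := hY'eq s ⟨hs.1, lt_of_lt_of_le hs.2 (min_le_right _ _)⟩
    simp only
    rw [← h1, ← h2, sub_self]
  have hev : ∀ᶠ z in 𝓝 (0 : ℂ), (fun z => Y z - Y' z) z = 0 :=
    eventually_eq_zero_of_forall_Ioo hD (lt_min hε hε') hD0
  have hYY' : Y =ᶠ[𝓝 (0 : ℂ)] Y' := by
    filter_upwards [hev] with z hz
    simpa [sub_eq_zero] using hz
  rw [hYY'.iteratedDeriv_eq j]
  exact hY'alg j (Nat.lt_succ_self j)

end Branch

/-- The real part of an algebraic complex number is algebraic. [folklore] -/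
theorem isAlgebraic_re {z : ℂ} (hz : IsAlgebraic ℚ z) : IsAlgebraic ℚ z.re := by
  have hconj : IsAlgebraic ℚ ((starRingEnd ℂ) z) := by
    have h := hz.algHom ((Complex.conjAe.restrictScalars ℚ).toAlgHom)
    simpa using h
  have hsum : IsAlgebraic ℚ ((z + (starRingEnd ℂ) z) * algebraMap ℚ ℂ (1 / 2)) :=
    (hz.add hconj).mul (isAlgebraic_algebraMap _)
  have hre : (z + (starRingEnd ℂ) z) * algebraMap ℚ ℂ (1 / 2) = algebraMap ℝ ℂ z.re := by
    rw [Complex.add_conj]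
    simp only [Complex.coe_algebraMap, eq_ratCast]
    push_cast
    ring
  rw [hre] at hsum
  exact (isAlgebraic_algebraMap_iff (algebraMap ℝ ℂ).injective).1 hsum

/-- Complex evaluation of the base change of a real two-variable polynomial at real points. [folklore] -/
theorem eval_map_ofReal (P : MvPolynomial (Fin 2) ℝ) (x y : ℝ) :
    MvPolynomial.eval ![(x : ℂ), (y : ℂ)] (MvPolynomial.map (algebraMap ℝ ℂ) P) =
      ((MvPolynomial.eval ![x, y] P : ℝ) : ℂ) := by
  rw [MvPolynomial.eval_map, show MvPolynomial.eval ![x, y] P = MvPolynomial.eval₂ (RingHom.id ℝ) ![x, y] P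
    from rfl, ← Complex.coe_algebraMap, MvPolynomial.eval₂_comp_left (algebraMap ℝ ℂ) (RingHom.id ℝ) ![x, y] P,
    RingHom.comp_id]
  congr 1
  funext i
  fin_cases i <;> rfl

/-- **The real Puiseux germ** (= `CurvePeriodsTransfer.stub_puiseuxGerm` of line `standard-etale-models`,
verbatim). [cite: BochnakCosteRoy1998, §8.1] [cite: Kollar2007, 1.94–1.95] -/
theorem puiseuxGerm : ∀ (f : ℝ → ℝ) (a δ : ℝ), IsAlgebraic ℚ a → 0 < δ →
    IsSemialgebraicFunOn ℚ {z : Fin 1 → ℝ | z 0 ∈ Set.Ioo a (a + δ)} (fun z => f (z 0)) →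
    ∃ (q : ℕ) (m : ℤ) (h : ℝ → ℝ), 0 < q ∧ AnalyticAt ℝ h 0 ∧ (∀ n, IsAlgebraic ℚ (iteratedDeriv n h 0)) ∧
      (h 0 ≠ 0 ∨ ∀ s, h s = 0) ∧ ∀ᶠ s in 𝓝[>] (0 : ℝ), f (a + s ^ q) = s ^ m * h s := by
  classical
  intro f a δ ha hδ hf
  -- Step 1: the first analytic cell `(a, b)` and the curve `P = 0` through the graph
  obtain ⟨B, hBsub, -, hcells⟩ := CurvePeriodsTransfer.stub_saPieceFacts.2 f a (a + δ) (by linarith) hf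
  obtain ⟨b, hab, hbB, hnoB⟩ : ∃ b, a < b ∧ (b = a + δ ∨ b ∈ B) ∧ ∀ x ∈ B, x ∉ Ioo a b := by
    by_cases hB : B.Nonempty
    · refine ⟨B.min' hB, (hBsub (B.min'_mem hB)).1, Or.inr (B.min'_mem hB), fun x hx hxI => ?_⟩
      exact absurd hxI.2 (not_lt.2 (B.min'_le x hx))
    · refine ⟨a + δ, by linarith, Or.inl rfl, fun x hx => ?_⟩
      exact absurd ⟨x, hx⟩ hB
  obtain ⟨P, hPalg, hcell⟩ := hcells a b hab (Or.inl rfl) hbB hnoB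
  -- Step 2: recentre over `k = algebraicClosure ℚ ℂ`
  obtain ⟨Pk, hPk⟩ := exists_polyK P hPalg ha
  have hvan : ∀ x ∈ Ioo a b,
      (Pk.map (eval₂RingHom (algebraMap (algebraicClosure ℚ ℂ) ℂ) ((x : ℂ) - a))).eval ((f x : ℝ) : ℂ) = 0 := by
    intro x hx
    rw [hPk, show (a : ℂ) + ((x : ℂ) - a) = (x : ℂ) by ring, eval_map_ofReal, (hcell x hx).2.1,
      Complex.ofReal_zero]
  have hPk0 : Pk ≠ 0 := by
    intro h0
    have hP0 : P = 0 := by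
      apply MvPolynomial.funext
      intro z
      have hz : z = ![z 0, z 1] := by funext i; fin_cases i <;> rfl
      have h := hPk ((z 0 : ℂ) - a) (z 1)
      rw [h0, Polynomial.map_zero, eval_zero, show (a : ℂ) + ((z 0 : ℂ) - a) = (z 0 : ℂ) by ring,
        eval_map_ofReal] at h
      rw [map_zero, hz]
      exact_mod_cast h.symm
    have hmid : (a + b) / 2 ∈ Ioo a b := ⟨by linarith, by linarith⟩
    have h := (hcell _ hmid).2.2.1
    rw [hP0, map_zero, map_zero] at h
    exact h rfl
  -- Step 3: an irreducible factor through the arc; formal and analytic branches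
  have hfan : ∀ x ∈ Ioo a b, AnalyticAt ℝ f x := fun x hx => (hcell x hx).1
  obtain ⟨Q, hQirr, hQdeg, hQvan⟩ := exists_irreducible_factor_vanishing Pk hPk0 hab hfan hvan
  haveI : IsAlgClosed (algebraicClosure ℚ ℂ) := (algebraicClosure.isAlgClosure ℚ ℂ).isAlgClosed
  obtain ⟨n, hn, N, S, -, hF⟩ :=
    exists_formalBranches Q (separable_map_laurent_of_irreducible Q hQirr hQdeg)
  have hlc : Polynomial.expand (algebraicClosure ℚ ℂ) n Q.leadingCoeff ≠ 0 := by
    rw [Ne, Polynomial.expand_eq_zero hn, leadingCoeff_eq_zero]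
    exact hQirr.ne_zero
  have hfc : ContinuousOn f (Ioo a b) := fun x hx => (hfan x hx).continuousAt.continuousWithinAt
  obtain ⟨Y, ε, hε, hYan, hYalg, hYeq⟩ := exists_realBranch Q S hn hF hlc hab hfc hQvan
  -- Step 4: normal form of the branch
  by_cases hY0 : ∀ᶠ z in 𝓝 (0 : ℂ), Y z = 0
  · -- the zero germ
    obtain ⟨r₁, hr₁, hball₁⟩ := Metric.eventually_nhds_iff_ball.1 hY0
    refine ⟨n, 0, fun _ => 0, hn, analyticAt_const, fun j => ?_, Or.inr fun _ => rfl, ?_⟩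
    · rw [iteratedDeriv_const]
      split_ifs <;> exact isAlgebraic_zero
    · filter_upwards [Ioo_mem_nhdsGT (lt_min hε hr₁)] with s hs
      have h1 := hYeq s ⟨hs.1, lt_of_lt_of_le hs.2 (min_le_left _ _)⟩
      have hsb : ((s : ℝ) : ℂ) ∈ Metric.ball (0 : ℂ) r₁ := by
        rw [Metric.mem_ball, dist_zero_right, Complex.norm_real, Real.norm_eq_abs, abs_of_pos hs.1]
        exact lt_of_lt_of_le hs.2 (min_le_right _ _)
      rw [hball₁ _ hsb, mul_eq_zero] at h1
      rcases h1 with h1 | h1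
      · exact absurd (pow_eq_zero_iff'.1 h1).1 (by exact_mod_cast hs.1.ne')
      · rw [zpow_zero, one_mul]
        exact_mod_cast h1
  · -- a non-zero germ: `Y = z^M · H`, `H 0 ≠ 0`
    obtain ⟨M, H, hHan, hH0, hYH⟩ := hYan.exists_eventuallyEq_pow_smul_nonzero_iff.2 hY0
    have hYH' : Y =ᶠ[𝓝 (0 : ℂ)] fun z => z ^ M * H z := by
      filter_upwards [hYH] with z hz
      simpa [sub_zero, smul_eq_mul] using hz
    obtain ⟨r₂, hr₂, hball₂⟩ := Metric.eventually_nhds_iff_ball.1 hYH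
    -- Taylor coefficients of `H` are algebraic
    have hHalg : ∀ j, IsAlgebraic ℚ (iteratedDeriv j H 0) := by
      intro j
      have h1 := hYalg (j + M)
      rw [hYH'.iteratedDeriv_eq, iteratedDeriv_pow_mul_eq hHan M j] at h1
      have hC : (((j + M).choose M * M.factorial : ℕ) : ℂ) ≠ 0 := by
        exact_mod_cast (Nat.mul_ne_zero (Nat.choose_pos (Nat.le_add_left M j)).ne' (Nat.factorial_ne_zero M))
      have h2 := (isAlgebraic_algebraMap (R := ℚ) (A := ℂ) ((((j + M).choose M * M.factorial : ℕ) : ℚ)⁻¹)).mul h1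
      have hC' : algebraMap ℚ ℂ ((((j + M).choose M * M.factorial : ℕ) : ℚ)⁻¹) *
          ((((j + M).choose M * M.factorial : ℕ) : ℂ) * iteratedDeriv j H 0) = iteratedDeriv j H 0 := by
        rw [map_inv₀, map_natCast, ← mul_assoc, inv_mul_cancel₀ hC, one_mul]
      rwa [hC'] at h2
    -- the interval where everything holds, and realness of `H` there
    have hε₂ : 0 < min ε r₂ := lt_min hε hr₂
    have hreal : ∀ s ∈ Ioo (0 : ℝ) (min ε r₂),
        ((s : ℝ) : ℂ) ^ N * ((f (a + s ^ n) : ℝ) : ℂ) = ((s : ℝ) : ℂ) ^ M * H s ∧ (H s).im = 0 := by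
      intro s hs
      have h1 := hYeq s ⟨hs.1, lt_of_lt_of_le hs.2 (min_le_left _ _)⟩
      have hsb : ((s : ℝ) : ℂ) ∈ Metric.ball (0 : ℂ) r₂ := by
        rw [Metric.mem_ball, dist_zero_right, Complex.norm_real, Real.norm_eq_abs, abs_of_pos hs.1]
        exact lt_of_lt_of_le hs.2 (min_le_right _ _)
      have h2 : Y s = ((s : ℝ) : ℂ) ^ M * H s := by
        have := hball₂ _ hsb
        simpa [sub_zero, smul_eq_mul] using this
      have h12 : ((s : ℝ) : ℂ) ^ N * ((f (a + s ^ n) : ℝ) : ℂ) = ((s : ℝ) : ℂ) ^ M * H s := h1.trans h2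
      refine ⟨h12, ?_⟩
      have hs0 : ((s : ℝ) : ℂ) ≠ 0 := by exact_mod_cast hs.1.ne'
      have hH : H s = ((s ^ N * f (a + s ^ n) / s ^ M : ℝ) : ℂ) := by
        push_cast
        rw [eq_div_iff (pow_ne_zero M hs0), mul_comm, ← h12]
      rw [hH, Complex.ofReal_im]
    -- `H 0` is real
    have hH0im : (H 0).im = 0 := by
      have ht : Tendsto (fun s : ℝ => (H s).im) (𝓝[>] 0) (𝓝 (H 0).im) := by
        have h2 : Tendsto (fun s : ℝ => ((s : ℝ) : ℂ)) (𝓝 0) (𝓝 0) := by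
          have := Complex.continuous_ofReal.continuousAt (x := (0 : ℝ))
          rwa [ContinuousAt, Complex.ofReal_zero] at this
        exact ((Complex.continuous_im.continuousAt.tendsto.comp hHan.continuousAt.tendsto).comp h2).mono_left
          nhdsWithin_le_nhds
      have ht0 : Tendsto (fun s : ℝ => (H s).im) (𝓝[>] 0) (𝓝 0) := by
        refine tendsto_const_nhds.congr' ?_
        filter_upwards [Ioo_mem_nhdsGT hε₂] with s hs
        exact ((hreal s hs).2).symm
      exact tendsto_nhds_unique ht ht0
    -- analyticity of `H` at the real points near `0`
    have hHanR : ∀ᶠ t : ℝ in 𝓝 0, AnalyticAt ℂ H ((t : ℝ) : ℂ) := by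
      have h2 : Tendsto (fun s : ℝ => ((s : ℝ) : ℂ)) (𝓝 0) (𝓝 0) := by
        have := Complex.continuous_ofReal.continuousAt (x := (0 : ℝ))
        rwa [ContinuousAt, Complex.ofReal_zero] at this
      exact h2.eventually hHan.eventually_analyticAt
    have hHan0 : AnalyticAt ℂ H ((0 : ℝ) : ℂ) := by rwa [Complex.ofReal_zero]
    refine ⟨n, (M : ℤ) - N, fun t => (H t).re, hn, hHan0.re_ofReal, fun j => ?_, Or.inl ?_, ?_⟩
    · -- algebraic Taylor coefficients of `h = Re H`
      rw [iteratedDeriv_re_ofReal_eq j hHanR, Complex.ofReal_zero]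
      exact isAlgebraic_re (hHalg j)
    · -- `h 0 ≠ 0`
      intro h0
      apply hH0
      have h0' : (H 0).re = 0 := by simpa using h0
      exact Complex.ext h0' hH0im
    · -- the germ identity
      filter_upwards [Ioo_mem_nhdsGT hε₂] with s hs
      obtain ⟨h12, him⟩ := hreal s hs
      have hs0 : ((s : ℝ) : ℂ) ≠ 0 := by exact_mod_cast hs.1.ne'
      have hHre : H s = (((H s).re : ℝ) : ℂ) := Complex.ext rfl (by rw [Complex.ofReal_im, him])
      apply Complex.ofReal_injective
      push_cast
      rw [← hHre, zpow_sub₀ hs0, zpow_natCast, zpow_natCast, div_mul_eq_mul_div,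
        eq_div_iff (pow_ne_zero N hs0), mul_comm (((f (a + s ^ n) : ℝ) : ℂ)), h12]

/-- **Registered anchor `helper_puiseuxGerm_2`** (= `puiseuxGerm`, = `CurvePeriodsTransfer.stub_puiseuxGerm`
verbatim): the real Puiseux germ of a one-variable `ℚ`-semialgebraic function. [cite: BochnakCosteRoy1998, §8.1] -/
theorem helper_puiseuxGerm_2 : ∀ (f : ℝ → ℝ) (a δ : ℝ), IsAlgebraic ℚ a → 0 < δ → IsSemialgebraicFunOn ℚ {z : Fin 1 → ℝ | z 0 ∈ Set.Ioo a (a + δ)} (fun z => f (z 0)) → ∃ (q : ℕ) (m : ℤ) (h : ℝ → ℝ), 0 < q ∧ AnalyticAt ℝ h 0 ∧ (∀ n, IsAlgebraic ℚ (iteratedDeriv n h 0)) ∧ (h 0 ≠ 0 ∨ ∀ s, h s = 0) ∧ ∀ᶠ s in 𝓝[>] (0 : ℝ), f (a + s ^ q) = s ^ m * h s :=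
  puiseuxGerm

end PuiseuxGerm

end Summit.KontsevichZagierPeriods.SymplecticScissors.RealOnePeriodRelations

end
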